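import Literature.AlgebraicGeometry.Resolution.KnafKuhlmann2009HenselianRationalityProofs
import Literature.AlgebraicGeometry.Resolution.InertiallyGeneratedValuationRings
import HarnessLib

/-!
# Knaf–Kuhlmann 2005, Thm. 3.4 in Hensel-root form

Topic: `Literature/AlgebraicGeometry/Resolution`. A step of the decomposition of the named facts
`KnafKuhlmann2009_Thm12` (Knaf–Kuhlmann 2009, Thm. 1.2 as printed; `SmoothUniformization.lean`)
and `KnafKuhlmann2009` (`LocalUniformization.lean`). After
`KnafKuhlmann2009HenselianRationalityProofs.lean` their trust base is
`{KnafKuhlmann2009_Thm38_sepClosed, KnafKuhlmann2005_Thm34_etale}`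
(`KnafKuhlmann2009_Thm12.of_thm38_henselRoot`): KK09 Thm. 3.8 (henselian rationality) in
HENSEL-ROOT form — `F = K(x)(η)` with `η` a root of a monic `f` over `O_{K(x)}`, `f'(η)` a unit —
and KK05 Thm. 3.4 (inertial generation of Abhyankar places) in the STANDARD-ÉTALE form of KK05 §5
— the Abhyankar elements `x, y`, the generator `η`, a monic prime `f` over `O_E`, `E = K(x, y)`,
the certificate `f'h + f p₂ = gˢ`, and the identification `O_F = (O_E[η]_{g(η)})_q`. This file
brings the second fact to the same Hensel-root form as the first:

* `KnafKuhlmann2005_Thm34_henselRoot` — NAMED FACT: KK05 Thm. 3.4 for a `K`-trivial place, with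
  conclusion c) ("`(F,P)` lies in the absolute inertia field of `(K(T),P)`") rendered, as for
  `KnafKuhlmann2009_Thm38_sepClosed`, by a Hensel root: Abhyankar elements `x, y` (the clauses of
  `KnafKuhlmann2005_Thm34_etale`, verbatim) and `η ∈ O_F` with `F = E(η)`, `E := K(x, y)`, `η` a
  root of a monic polynomial `f` over `O_E` with `f'(η)` a unit of `O_P`. No least-degree clause
  (it is a theorem: the minimal polynomial `μ` of `η` over the normal domain `O_E` divides `f`,
  so `μ'(η)` is a unit as well).
* `exists_standardEtale_data_of_henselRoot` — PROVED: from a Hensel root `η` over `O_E`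
  generating `F` over ANY subfield `E`, the standard-étale data of KK05 §5 with `f := μ`,
  `g := μ'`, `h := 1`, `p₂ := 0`, `s := 1`, the least-degree clause, and `O_F = O_E[η]_q`
  (every `z ∈ O_F` is `a(η)/b(η)`, `b(η)` a unit) — the argument of
  `KnafKuhlmann2009_Thm38_localEtale_sepClosed.of_thm38` for a general `E`, the last clause by
  `exists_div_of_valuation_derivative_eq_one` (`InertiallyGeneratedValuationRings.lean`:
  `O_{E(η)} = (O_E[η])_q`, integral closure of the valuation ring `O_E` in `E(η)` + Euler's lemma
  `μ'(η) N ⊆ O_E[η]`).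
* `KnafKuhlmann2005_Thm34_etale.of_henselRoot`, `KnafKuhlmann2005_Thm34_henselRoot.of_etale` —
  PROVED: the two renderings of KK05 Thm. 3.4 are EQUIVALENT modulo proved mathematics (the
  converse evaluates `f'h + f p₂ = gˢ` at `η`), so the new fact replaces the old one in the trust
  base rather than adding to it.
* `KnafKuhlmann2005_Thm11.of_henselRoot`, `KnafKuhlmann2009_Thm12.of_henselRoots`,
  `KnafKuhlmann2009.of_henselRoots` — bookkeeping: KK05 Thm. 1.1, KK09 Thm. 1.2 (as printed) and
  the fact `KnafKuhlmann2009` from `{KnafKuhlmann2009_Thm38_sepClosed,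
  KnafKuhlmann2005_Thm34_henselRoot}` — henselian rationality and inertial generation, each as
  the existence of a Hensel-root generator over `O_{K(T)}`.

## Sources

* [KK05] H. Knaf, F.-V. Kuhlmann, *Abhyankar places admit local uniformization in any
  characteristic*, Ann. Sci. ÉNS 38 (2005) 833–846 = arXiv:math/0304159: Thm. 3.4 (p. 7 of the
  16-page arXiv text: "Then `(F|K,P)` is inertially generated, by which we mean that there is a
  transcendence basis `T = {x₁,…,x_ρ,y₁,…,y_τ}` such that a) `v_P F = v_P K ⊕ ℤv_P x₁ ⊕ … ⊕
  ℤv_P x_ρ`, b) `y₁P,…,y_τP` is a separating transcendence basis of `FP|KP`, c) `(F,P)` lies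
  in the absolute inertia field of `(K(T),P)`") and §5 (p. 12: "`O_F = A_q` for an étale
  `O_E`-algebra `A` and `q = A ∩ M_F`. According to [Ray], Ch. V, Thm. 1 we can assume that `A`
  is standard-étale, i.e., `A = O_E[x]_{g(x)}`, where `O_E[x] = O_E[X]/fO_E[X]` with a monic
  polynomial `f ∈ O_E[X]`. Furthermore, `g ∈ O_E[X]` is chosen such that the image of the
  derivative `f'` under the natural morphism `φ : O_E[X] → A` is a unit.").
* [KK09] H. Knaf, F.-V. Kuhlmann, *Every place admits local uniformization in a finite extension
  of the function field*, Adv. Math. 221 (2009) 428–453 = arXiv:math/0702856, Lemma 3.7 (p. 13 of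
  the 19-page arXiv text) and Thm. 1.2.
* [K8] F.-V. Kuhlmann, *Elimination of ramification II: Henselian rationality*, Israel J. Math.
  234 (2019) 927–958 = arXiv:1701.05508, proof of Prop. 6.1 (p. 14: a finite extension within the
  henselization "is generated by a henselian element `η` […], that is, the coefficients of its
  minimal polynomial `h` over `K'(T)` lie in the valuation ring of `K'(T)`, and `vh'(η) = 0`").

## Rendering notes

As in `AbhyankarEtaleAscent.lean` and `KnafKuhlmann2009HenselianRationality.lean`: `(Ω, V)` a
valued field, `K ≤ F` subfields, `E = K(x, y) = Subfield.closure (K ∪ (range x ∪ range y))`,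
`E(η) = Subfield.closure (E ∪ {η})`, polynomials "over `O_E`" = polynomials over `Ω` with
coefficients in `V ∩ E`, units have value `1`. The hypotheses and the Abhyankar clauses of
`KnafKuhlmann2005_Thm34_henselRoot` are those of `KnafKuhlmann2005_Thm34_etale` verbatim; the
Hensel-root clause is that of `KnafKuhlmann2009_Thm38_sepClosed` verbatim (with `E` for `K(x)`).
-/

noncomputable section

namespace Literature.AlgebraicGeometry.Resolution

universe u

open IsLocalRing Polynomial

/-- NAMED FACT — **Knaf–Kuhlmann 2005, Thm. 3.4, for a `K`-trivial place, in Hensel-root form**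
(Thm. 3.4: "Assume that `(F|K,P)` is a valued function field without transcendence defect such
that `FP|KP` is a separable extension, `(K,P)` is a defectless field and `v_P F/v_P K` is
torsion-free. Then `(F|K,P)` is inertially generated, by which we mean that there is a
transcendence basis `T = {x₁,…,x_ρ,y₁,…,y_τ}` such that a) `v_P F = v_P K ⊕ ℤv_P x₁ ⊕ … ⊕
ℤv_P x_ρ`, b) `y₁P,…,y_τP` is a separating transcendence basis of `FP|KP`, c) `(F,P)` lies in
the absolute inertia field of `(K(T),P)`"; §5, p. 12: for `F` in the absolute inertia field of
`E`, "`O_F = A_q` for an étale `O_E`-algebra `A` […] `A = O_E[x]_{g(x)}`, where `O_E[x] =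
O_E[X]/fO_E[X]` with a monic polynomial `f ∈ O_E[X]`. Furthermore, `g ∈ O_E[X]` is chosen such
that the image of the derivative `f'` under the natural morphism `φ : O_E[X] → A` is a unit" — so
`x := φ(X) ∈ O_F` generates `F = Frac A_q` over `E` and is a root of the monic `f` over `O_E` with
`f'(x) ∈ A^× ⊆ O_F^×`). Vendored for a `K`-TRIVIAL place (`K ⊆ O_P`; then `(K, P)` is defectless
and `v_P F/v_P K = v_P F` is torsion-free, so Thm. 3.4 applies to an Abhyankar place with `FP|KP`
separable): Abhyankar elements `xᵢ ∈ F^×` with `ℤ`-independent values and `yⱼ ∈ O_P ∩ F` with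
residues algebraically independent over `KP` (consequences of a), b); the separating clause of
b) is not rendered), and, with `E := K(x, y)`, an element `η ∈ O_P` with `F = E(η)` which is a
root of a monic polynomial `f` over `O_E` whose derivative `f'(η)` is a unit of `O_P`. This is the
Hensel-root form of `KnafKuhlmann2005_Thm34_etale` (`AbhyankarEtaleAscent.lean`), to which it is
equivalent (`KnafKuhlmann2005_Thm34_etale.of_henselRoot`, `KnafKuhlmann2005_Thm34_henselRoot.of_etale`),
in the same rendering as `KnafKuhlmann2009_Thm38_sepClosed`. Users take
`(h : KnafKuhlmann2005_Thm34_henselRoot)`. [cite: KnafKuhlmann2005, Thm. 3.4 and Section 5 (p. 12)] -/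
def KnafKuhlmann2005_Thm34_henselRoot : Prop :=
  ∀ (Ω : Type u) [Field Ω] (V : ValuationSubring Ω) (K F : Subfield Ω),
    K ≤ F → FGOver K F → (K : Set Ω) ⊆ V → IsAbhyankarPlace V K F →
    SeparablyGeneratedOver (resField V K) (resField V F) →
    ∃ (ρ τ : ℕ) (x : Fin ρ → Ω) (y : Fin τ → Ω) (hy : ∀ j, y j ∈ V),
      (∀ i, x i ∈ F ∧ x i ≠ 0) ∧ (∀ j, y j ∈ F) ∧
      (∀ m : Fin ρ → ℤ, (∃ b ∈ K, (∏ i, V.valuation (x i) ^ (m i)) = V.valuation b) → m = 0) ∧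
      AlgebraicIndependent (resField V K) (fun j => residue V ⟨y j, hy j⟩) ∧
      ∃ η ∈ V, ∃ f : Polynomial Ω,
        Subfield.closure ((Subfield.closure ((K : Set Ω) ∪ (Set.range x ∪ Set.range y)) : Set Ω)
          ∪ {η}) = F ∧
        f.Monic ∧
        (∀ k, f.coeff k ∈ V ∧
          f.coeff k ∈ Subfield.closure ((K : Set Ω) ∪ (Set.range x ∪ Set.range y))) ∧
        f.eval η = 0 ∧ V.valuation ((Polynomial.derivative f).eval η) = 1

variable {Ω : Type u} [Field Ω]

/-! ## From a Hensel root to the standard-étale data -/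

/-- **Hensel root ⇒ standard-étale data** (the argument of
`KnafKuhlmann2009_Thm38_localEtale_sepClosed.of_thm38`, over an arbitrary subfield `E`): if
`F = E(η)` with `η ∈ O_V` a root of a monic `f` over `O_E = V ∩ E` with `v(f'(η)) = 1`, then the
minimal polynomial `μ` of `η` over the normal domain `O_E` — monic over `O_E`, of least degree
among the non-zero polynomials over `E = Frac O_E` vanishing at `η` — has `v(μ'(η)) = 1`, the
certificate `μ' · 1 + μ · 0 = (μ')¹` holds, and every `z ∈ O_V ∩ F` is `a(η)/(b(η) μ'(η)⁰)` with
`a, b` over `O_E` and `v(b(η)) = 1` (`exists_div_of_valuation_derivative_eq_one`,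
`InertiallyGeneratedValuationRings.lean`: `O_F = O_E[η]_q`). [cite: KnafKuhlmann2009, Lemma 3.7] -/
theorem exists_standardEtale_data_of_henselRoot (V : ValuationSubring Ω) (E F : Subfield Ω)
    {η : Ω} (hηV : η ∈ V) (hgen : Subfield.closure ((E : Set Ω) ∪ {η}) = F) (f : Polynomial Ω)
    (hfmon : f.Monic) (hcoef : ∀ k, f.coeff k ∈ V ∧ f.coeff k ∈ E) (hfη : f.eval η = 0)
    (hfder : V.valuation ((derivative f).eval η) = 1) :
    ∃ (f₁ g h p₂ : Polynomial Ω) (s : ℕ),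
      f₁.Monic ∧ f₁.eval η = 0 ∧
      (∀ P ∈ ({f₁, g, h, p₂} : Set (Polynomial Ω)), ∀ k, P.coeff k ∈ V ∧ P.coeff k ∈ E) ∧
      (∀ P : Polynomial Ω, (∀ k, P.coeff k ∈ E) → P ≠ 0 → P.eval η = 0 →
        f₁.natDegree ≤ P.natDegree) ∧
      derivative f₁ * h + f₁ * p₂ = g ^ s ∧
      V.valuation (g.eval η) = 1 ∧
      ∀ z ∈ F, z ∈ V → ∃ (a b : Polynomial Ω) (k : ℕ),
        (∀ P ∈ ({a, b} : Set (Polynomial Ω)), ∀ k, P.coeff k ∈ V ∧ P.coeff k ∈ E) ∧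
        V.valuation (b.eval η) = 1 ∧ z = a.eval η / (b.eval η * g.eval η ^ k) := by
  classical
  set O : Subring Ω := V.toSubring ⊓ E.toSubring with hOdef
  haveI : IsIntegrallyClosed O := isIntegrallyClosed_inf V E
  -- `f` over `O_E`; `η` is integral with minimal polynomial `μ`; `μ'(η)` is a unit
  obtain ⟨fO, hfO, hfOmon'⟩ := exists_map_eq_of_coeff_mem_subring O f fun k => ⟨(hcoef k).1, (hcoef k).2⟩
  have hfOmon : fO.Monic := hfOmon' hfmon
  have hfOη : aeval η fO = 0 := by rw [aeval_def, ← eval_map, hfO, hfη]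
  have hint : IsIntegral O η := ⟨fO, hfOmon, by rw [← aeval_def, hfOη]⟩
  set μ := minpoly O η with hμ
  have hmapcoef : ∀ (q : Polynomial O) (k : ℕ),
      (q.map (algebraMap O Ω)).coeff k ∈ V ∧ (q.map (algebraMap O Ω)).coeff k ∈ E := by
    intro q k
    rw [coeff_map]
    exact ⟨(q.coeff k).2.1, (q.coeff k).2.2⟩
  have hmapeval : ∀ q : Polynomial O, (q.map (algebraMap O Ω)).eval η = aeval η q := fun q => by
    rw [eval_map, aeval_def]
  have hOval : ∀ q : Polynomial O, V.valuation (aeval η q) ≤ 1 := fun q =>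
    (V.valuation_le_one_iff _).mpr (by
      rw [← hmapeval]
      exact eval_mem_of_coeff_mem V _ (fun k => (hmapcoef q k).1) hηV)
  have hder : V.valuation (aeval η (derivative μ)) = 1 := by
    obtain ⟨g, hg⟩ := minpoly.isIntegrallyClosed_dvd hint hfOη
    have h1 : (derivative f).eval η = aeval η (derivative μ) * aeval η g := by
      rw [← hfO, derivative_map, eval_map, ← aeval_def, hg, derivative_mul, map_add, map_mul,
        map_mul, minpoly.aeval, zero_mul, add_zero]
    rw [h1, map_mul] at hfder
    refine le_antisymm (hOval _) ?_
    calc (1 : V.ValueGroup) = V.valuation (aeval η (derivative μ)) * V.valuation (aeval η g) :=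
          hfder.symm
      _ ≤ V.valuation (aeval η (derivative μ)) := mul_le_of_le_one_right' (hOval g)
  have hder' : V.valuation ((derivative (μ.map (algebraMap O Ω))).eval η) = 1 := by
    rw [derivative_map, hmapeval]; exact hder
  have hμη : (μ.map (algebraMap O Ω)).eval η = 0 := by rw [hmapeval, minpoly.aeval]
  have hμmon : (μ.map (algebraMap O Ω)).Monic := (minpoly.monic hint).map _
  -- least degree: `μ` is also the minimal polynomial of `η` over the field `E = Frac O_E`
  have hminimal : ∀ P : Polynomial Ω, (∀ k, P.coeff k ∈ E) → P ≠ 0 → P.eval η = 0 →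
      (μ.map (algebraMap O Ω)).natDegree ≤ P.natDegree := by
    intro P hPE hP0 hPη
    let ι : O →+* E := Subring.inclusion (inf_le_right : V.toSubring ⊓ E.toSubring ≤ E.toSubring)
    letI : Algebra O E := ι.toAlgebra
    haveI : IsScalarTower O E Ω := IsScalarTower.of_algebraMap_eq fun _ => rfl
    haveI : IsFractionRing O E := isFractionRing_inf V E
    have hmin : minpoly E η = μ.map (algebraMap O E) :=
      minpoly.isIntegrallyClosed_eq_field_fractions' E hint
    obtain ⟨PE, hPE'⟩ : ∃ PE : Polynomial E, PE.map (algebraMap E Ω) = P :=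
      (Polynomial.mem_lifts P).mp
        ((Polynomial.lifts_iff_coeff_lifts P).mpr fun k => ⟨⟨P.coeff k, hPE k⟩, rfl⟩)
    have hPE0 : PE ≠ 0 := by
      rintro rfl
      rw [Polynomial.map_zero] at hPE'
      exact hP0 hPE'.symm
    have hPEη : aeval η PE = 0 := by rw [aeval_def, ← eval_map, hPE', hPη]
    have h1 : (minpoly E η).natDegree ≤ PE.natDegree :=
      natDegree_le_of_dvd (minpoly.dvd E η hPEη) hPE0
    rw [natDegree_map_eq_of_injective Subtype.val_injective]
    calc μ.natDegree = (minpoly E η).natDegree := by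
          rw [hmin, natDegree_map_eq_of_injective (Subring.inclusion_injective _)]
      _ ≤ PE.natDegree := h1
      _ = P.natDegree := by rw [← hPE', natDegree_map_eq_of_injective Subtype.val_injective]
  refine ⟨μ.map (algebraMap O Ω), (derivative μ).map (algebraMap O Ω), 1, 0, 1, hμmon, hμη,
    ?_, hminimal, ?_, ?_, ?_⟩
  · intro P hP k
    simp only [Set.mem_insert_iff, Set.mem_singleton_iff] at hP
    rcases hP with rfl | rfl | rfl | rfl
    · exact hmapcoef _ k
    · exact hmapcoef _ k
    · rw [coeff_one]
      split_ifs
      · exact ⟨V.one_mem, E.one_mem⟩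
      · exact ⟨V.zero_mem, E.zero_mem⟩
    · rw [coeff_zero]; exact ⟨V.zero_mem, E.zero_mem⟩
  · rw [← derivative_map, mul_one, mul_zero, add_zero, pow_one]
  · rw [hmapeval]
    exact hder
  · -- `O_F = O_E[η]_q` (`exists_div_of_valuation_derivative_eq_one`)
    intro z hzF hzV
    rw [← hgen] at hzF
    obtain ⟨a, b, ha, hb, hvb, hz⟩ := exists_div_of_valuation_derivative_eq_one V E
      (hmapcoef μ) hμmon hμη hminimal hder' hzF hzV
    refine ⟨a, b, 0, ?_, hvb, by rw [pow_zero, mul_one]; exact hz⟩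
    intro P hP k
    simp only [Set.mem_insert_iff, Set.mem_singleton_iff] at hP
    rcases hP with rfl | rfl
    · exact ha k
    · exact hb k

/-! ## The two renderings of KK05 Thm. 3.4 are equivalent -/

/-- **KK05 Thm. 3.4 in the standard-étale rendering (`KnafKuhlmann2005_Thm34_etale`) from its
Hensel-root form**: keep the Abhyankar elements and take the standard-étale data of
`exists_standardEtale_data_of_henselRoot` (minimal polynomial `μ` of `η` over `O_E`, `g := μ'`).
[cite: KnafKuhlmann2005, Thm. 3.4 and Section 5 (p. 12)] -/
theorem KnafKuhlmann2005_Thm34_etale.of_henselRoot (h : KnafKuhlmann2005_Thm34_henselRoot.{u}) :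
    KnafKuhlmann2005_Thm34_etale.{u} := by
  intro Ω _ V K F hKF hfg hKV hAbh hsep
  obtain ⟨ρ, τ, x, y, hy, hxF, hyF, hxi, hri, η, hηV, f, hgen, hfmon, hcoef, hfη, hfder⟩ :=
    h Ω V K F hKF hfg hKV hAbh hsep
  obtain ⟨f₁, g, hh, p₂, s, hf₁mon, hf₁η, hcoef₁, hmin, hident, hvg, hOF⟩ :=
    exists_standardEtale_data_of_henselRoot V _ F hηV hgen f hfmon hcoef hfη hfder
  exact ⟨ρ, τ, x, y, hy, hxF, hyF, hxi, hri, η, f₁, g, hh, p₂, s, hηV, hgen, hf₁mon, hf₁η, hcoef₁,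
    hmin, hident, hvg, hOF⟩

/-- **The Hensel-root form from the standard-étale rendering**: the prime `f` of the
standard-étale data is itself a Hensel root equation, since evaluating `f'h + f p₂ = gˢ` at the
root `η` of `f` gives `f'(η) h(η) = g(η)ˢ ∈ O_P^×` with `f'(η), h(η) ∈ O_P`, whence
`v(f'(η)) = 1` (the argument of `KnafKuhlmann2009_Thm38_sepClosed.of_localEtale`). [folklore] -/
theorem KnafKuhlmann2005_Thm34_henselRoot.of_etale (h : KnafKuhlmann2005_Thm34_etale.{u}) :
    KnafKuhlmann2005_Thm34_henselRoot.{u} := by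
  intro Ω _ V K F hKF hfg hKV hAbh hsep
  obtain ⟨ρ, τ, x, y, hy, hxF, hyF, hxi, hri, η, f, g, hh, p₂, s, hηV, hgen, hfmon, hfη, hcoef, -,
    hident, hvg, -⟩ := h Ω V K F hKF hfg hKV hAbh hsep
  refine ⟨ρ, τ, x, y, hy, hxF, hyF, hxi, hri, η, hηV, f, hgen, hfmon, hcoef f (by simp), hfη, ?_⟩
  -- values of polynomials over `O_E` at `η ∈ O_V` are `≤ 1`
  have hval : ∀ P : Polynomial Ω, (∀ k, P.coeff k ∈ V) → V.valuation (P.eval η) ≤ 1 :=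
    fun P hP => (V.valuation_le_one_iff _).mpr (eval_mem_of_coeff_mem V P hP hηV)
  have hderV : ∀ k, (derivative f).coeff k ∈ V := fun k => by
    rw [coeff_derivative]
    exact mul_mem (hcoef f (by simp) _).1 (by exact_mod_cast natCast_mem V (k + 1))
  have heval : (derivative f).eval η * hh.eval η = g.eval η ^ s := by
    have := congrArg (fun P : Polynomial Ω => P.eval η) hident
    simpa only [eval_add, eval_mul, hfη, zero_mul, add_zero, eval_pow] using this
  refine le_antisymm (hval _ hderV) ?_
  calc (1 : V.ValueGroup) = V.valuation (g.eval η ^ s) := by rw [map_pow, hvg, one_pow]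
    _ = V.valuation ((derivative f).eval η) * V.valuation (hh.eval η) := by
        rw [← heval, map_mul]
    _ ≤ V.valuation ((derivative f).eval η) :=
        mul_le_of_le_one_right' (hval hh fun k => (hcoef hh (by simp) k).1)

/-! ## Corollaries: KK05 Thm. 1.1, KK09 Thm. 1.2 and `KnafKuhlmann2009` from the two Hensel-root facts -/

/-- **Knaf–Kuhlmann 2005, Thm. 1.1 from Thm. 3.4 in Hensel-root form** (through the standard-étale
rendering and `KnafKuhlmann2005_Thm11.of_parts`, Lemma 5.1). [cite: KnafKuhlmann2005, Thm. 1.1] -/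
theorem KnafKuhlmann2005_Thm11.of_henselRoot (h34 : KnafKuhlmann2005_Thm34_henselRoot.{u}) :
    KnafKuhlmann2005_Thm11.{u} :=
  KnafKuhlmann2005_Thm11.of_parts (KnafKuhlmann2005_Thm34_etale.of_henselRoot h34)

/-- **Knaf–Kuhlmann 2009, Thm. 1.2 (as printed, first paragraph) from the two Hensel-root
facts**: its trust base is `{KnafKuhlmann2009_Thm38_sepClosed, KnafKuhlmann2005_Thm34_henselRoot}`
— henselian rationality (KK09 Thm. 3.8, [K8]) and inertial generation of Abhyankar places (KK05
Thm. 3.4, Generalized Stability Theorem), each as the existence of a Hensel-root generator of `F`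
over `O_{K(T)}` for a suitable transcendence basis `T`. [cite: KnafKuhlmann2009, Thm. 1.2] -/
theorem KnafKuhlmann2009_Thm12.of_henselRoots (h38 : KnafKuhlmann2009_Thm38_sepClosed.{u})
    (h34 : KnafKuhlmann2005_Thm34_henselRoot.{u}) : KnafKuhlmann2009_Thm12.{u} :=
  KnafKuhlmann2009_Thm12.of_thm38_henselRoot h38 (KnafKuhlmann2005_Thm34_etale.of_henselRoot h34)

/-- **The named fact `KnafKuhlmann2009` from the two Hensel-root facts**: trust base
`{KnafKuhlmann2009_Thm38_sepClosed, KnafKuhlmann2005_Thm34_henselRoot}`.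
[cite: KnafKuhlmann2009, Thm. 1.2] -/
theorem KnafKuhlmann2009.of_henselRoots (h38 : KnafKuhlmann2009_Thm38_sepClosed.{u})
    (h34 : KnafKuhlmann2005_Thm34_henselRoot.{u}) : KnafKuhlmann2009.{u} :=
  KnafKuhlmann2009.of_thm38_henselRoot h38 (KnafKuhlmann2005_Thm34_etale.of_henselRoot h34)

end Literature.AlgebraicGeometry.Resolution

end
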